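import Summits.Ventures.PercRepro.S1CFGSimpleFive

/-!
# PercRepro — THE CAPS OF A SIMPLE COLOOP-FREE MATROID OF NULLITY `5` ON `13` AND `14` POINTS, BY NUMBER (p1, gen 38)

The numerals of S1CFGSimpleFive at `ν = 5` for p7's case (IV) of the cell `(13, 9)` (`N = M ／ W` simple, coloop-free,
nullity `5`, `13` points at `w = 9`, `14` points at `w = 8`), in the rank forms `{X | X ⊆ E ∧ |X| = k ∧ rk X ≤ s}.ncard`:

| `n` | `Q₃² = D₃` | `Q₄²` | `Q₄³ = D₄` | `Q₅²` | `Q₅³` |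
|---|---|---|---|---|---|
| 13 | 35 | 26 | 420 | 10 | 298 |
| 14 | 35 | 26 | 455 | 10 | 325 |

(`Q₂¹ = Q₃¹ = Q₄¹ = Q₅¹ = 0` for a simple matroid — `Q₃¹`, `Q₄¹` are S1CFSimpleCaps; `4 · Q₄² ≤ 3 · 35 = 105`,
`5 · Q₅² ≤ 2 · 26 = 52`, `5 · Q₅³ ≤ 3 · D₄ + (n − 4) · 26`.) Nothing about any cell is claimed. Axioms: standard.
-/

open scoped Matroid

namespace PercRepro

namespace S1CFG

open Set S1CF

variable {α : Type}

/-- The rank of a nullity-`5` matroid on `n` points is `n − 5`. -/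
theorem eRk_ground_toNat_eq_of_five (M : Matroid α) [M.Finite] (hd : M.E.encard = M.eRank + ((5 : ℕ) : ℕ∞)) :
    (M.eRk M.E).toNat = M.E.ncard - 5 := by
  have := ncard_ground_eq_eRk_toNat_add M hd
  omega

/-- `D₃ ≤ 35` for a simple matroid of nullity `5`. -/
theorem ncard_three_eRk_le_two_le_thirtyfive_of_no_dep_pair (M : Matroid α) [M.Finite]
    (hd : M.E.encard = M.eRank + ((5 : ℕ) : ℕ∞))
    (h0 : {P : Set α | P ⊆ M.E ∧ P.ncard = 2 ∧ M.Dep P}.ncard = 0) :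
    {X : Set α | X ⊆ M.E ∧ X.ncard = 3 ∧ M.eRk X ≤ 2}.ncard ≤ 35 := by
  have := ncard_three_eRk_le_two_le_of_no_dep_pair M hd h0
  have hc : (5 + 2 : ℕ).choose 3 = 35 := by decide
  rw [hc] at this
  exact this

/-- `Q₄² ≤ 26` for a simple coloop-free matroid of nullity `5` on `n ≥ 8` points. -/
theorem ncard_four_eRk_le_two_le_twentysix_of_no_dep_pair (M : Matroid α) [M.Finite] (hK : ∀ e, ¬ M.IsColoop e)
    (hd : M.E.encard = M.eRank + ((5 : ℕ) : ℕ∞))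
    (h0 : {P : Set α | P ⊆ M.E ∧ P.ncard = 2 ∧ M.Dep P}.ncard = 0) (hn : 8 ≤ M.E.ncard) :
    {X : Set α | X ⊆ M.E ∧ X.ncard = 4 ∧ M.eRk X ≤ 2}.ncard ≤ 26 := by
  have hr := eRk_ground_toNat_eq_of_five M hd
  have := four_mul_ncard_four_eRk_le_two_le_of_no_dep_pair M hK hd h0 (by omega)
  have hc : (5 + 2 : ℕ).choose 3 = 35 := by decide
  rw [hc] at this
  omega

/-- `D₄ ≤ 35 · (n − 3) + 70` for a simple matroid of nullity `5`. -/
theorem ncard_four_eRk_le_three_le_of_no_dep_pair_five (M : Matroid α) [M.Finite]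
    (hd : M.E.encard = M.eRank + ((5 : ℕ) : ℕ∞))
    (h0 : {P : Set α | P ⊆ M.E ∧ P.ncard = 2 ∧ M.Dep P}.ncard = 0) :
    {X : Set α | X ⊆ M.E ∧ X.ncard = 4 ∧ M.eRk X ≤ 3}.ncard ≤ (M.E.ncard - 3) * 35 + 70 := by
  have := ncard_four_eRk_le_three_le_of_no_dep_pair M hd h0
  have hc3 : (5 + 2 : ℕ).choose 3 = 35 := by decide
  have hc4 : (5 + 3 : ℕ).choose 4 = 70 := by decide
  rw [hc3, hc4] at this
  exact this

/-- `Q₅² ≤ 10` for a simple coloop-free matroid of nullity `5` on `n ≥ 8` points. -/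
theorem ncard_five_eRk_le_two_le_ten_of_no_dep_pair (M : Matroid α) [M.Finite] (hK : ∀ e, ¬ M.IsColoop e)
    (hd : M.E.encard = M.eRank + ((5 : ℕ) : ℕ∞))
    (h0 : {P : Set α | P ⊆ M.E ∧ P.ncard = 2 ∧ M.Dep P}.ncard = 0) (hn : 8 ≤ M.E.ncard) :
    {X : Set α | X ⊆ M.E ∧ X.ncard = 5 ∧ M.eRk X ≤ 2}.ncard ≤ 10 := by
  have hr := eRk_ground_toNat_eq_of_five M hd
  have h1 := five_mul_ncard_five_eRk_le_two_le_of_no_dep_pair M hK hd h0 (by omega)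
  have h2 := ncard_four_eRk_le_two_le_twentysix_of_no_dep_pair M hK hd h0 hn
  have h3 : (5 - 3) * {X : Set α | X ⊆ M.E ∧ X.ncard = 4 ∧ M.eRk X ≤ 2}.ncard ≤ (5 - 3) * 26 :=
    Nat.mul_le_mul_left _ h2
  omega

/-- `Q₅³ ≤ 298` for a simple coloop-free matroid of nullity `5` on `13` points. -/
theorem ncard_five_eRk_le_three_le_thirteen_of_no_dep_pair (M : Matroid α) [M.Finite] (hK : ∀ e, ¬ M.IsColoop e)
    (hd : M.E.encard = M.eRank + ((5 : ℕ) : ℕ∞))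
    (h0 : {P : Set α | P ⊆ M.E ∧ P.ncard = 2 ∧ M.Dep P}.ncard = 0) (hn : M.E.ncard = 13) :
    {X : Set α | X ⊆ M.E ∧ X.ncard = 5 ∧ M.eRk X ≤ 3}.ncard ≤ 298 := by
  have hr := eRk_ground_toNat_eq_of_five M hd
  have h1 := five_mul_ncard_five_eRk_le_three_le M hK hd (by omega)
  have h2 := ncard_four_eRk_le_two_le_twentysix_of_no_dep_pair M hK hd h0 (by omega)
  have h3 := ncard_four_eRk_le_three_le_of_no_dep_pair_five M hd h0
  rw [hn] at h1 h3
  have h4 : (5 - 2) * {X : Set α | X ⊆ M.E ∧ X.ncard = 4 ∧ M.eRk X ≤ 3}.ncard ≤ (5 - 2) * ((13 - 3) * 35 + 70) :=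
    Nat.mul_le_mul_left _ h3
  have h5 : (13 - 4) * {X : Set α | X ⊆ M.E ∧ X.ncard = 4 ∧ M.eRk X ≤ 2}.ncard ≤ (13 - 4) * 26 :=
    Nat.mul_le_mul_left _ h2
  omega

/-- `Q₅³ ≤ 325` for a simple coloop-free matroid of nullity `5` on `14` points. -/
theorem ncard_five_eRk_le_three_le_fourteen_of_no_dep_pair (M : Matroid α) [M.Finite] (hK : ∀ e, ¬ M.IsColoop e)
    (hd : M.E.encard = M.eRank + ((5 : ℕ) : ℕ∞))
    (h0 : {P : Set α | P ⊆ M.E ∧ P.ncard = 2 ∧ M.Dep P}.ncard = 0) (hn : M.E.ncard = 14) :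
    {X : Set α | X ⊆ M.E ∧ X.ncard = 5 ∧ M.eRk X ≤ 3}.ncard ≤ 325 := by
  have hr := eRk_ground_toNat_eq_of_five M hd
  have h1 := five_mul_ncard_five_eRk_le_three_le M hK hd (by omega)
  have h2 := ncard_four_eRk_le_two_le_twentysix_of_no_dep_pair M hK hd h0 (by omega)
  have h3 := ncard_four_eRk_le_three_le_of_no_dep_pair_five M hd h0
  rw [hn] at h1 h3
  have h4 : (5 - 2) * {X : Set α | X ⊆ M.E ∧ X.ncard = 4 ∧ M.eRk X ≤ 3}.ncard ≤ (5 - 2) * ((14 - 3) * 35 + 70) :=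
    Nat.mul_le_mul_left _ h3
  have h5 : (14 - 4) * {X : Set α | X ⊆ M.E ∧ X.ncard = 4 ∧ M.eRk X ≤ 2}.ncard ≤ (14 - 4) * 26 :=
    Nat.mul_le_mul_left _ h2
  omega

end S1CFG

end PercRepro
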